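import Summits.Ventures.CertifiedManyBodySolver.Observables.SourcedGibbsTrialCapAFDiag
import HarnessLib

/-!
# The HF–BCS sourced cap in momentum space (XIV-b): the diagonal of `𝓗·F` for the antiferromagnetic + `d`-wave-pinned
# torus as momentum sums (the one-body ENERGY input `Σ_{ij} 𝓗_{ij} F_{ji}` of the generalized-Hartree–Fock cap)

HONEST FRAMING: zero compute; PROVED finite-volume identities; no number is claimed; the staggered field is a variational device;
not a statement about order; not a superconductivity verdict.

Cell `hubbard-obs` (D-0042 / D-0082), seat `hubbard-obs-pin-2` (`prover-hubbard-obs-pin-2-g7-0`).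

* `afNambu_mul_fermi_diag_zero/one` — `(𝓗F)((x,σ),(x,σ)) = L⁻² Σ_p [u_σ(p) + (−1)^x t_σ(p)]` with
  `u_↑ = c₀₀ξ + c₁₀G + c_Q₀M`, `t_↑ = c₀₀M + c_Q₀ξ_Q + c_Q₁G_Q`, `u_↓ = d₀₁G − d₁₁ξ + d_Q₁M`, `t_↓ = d₁₁M + d_Q₀G_Q − d_Q₁ξ_Q`
  (`ξ_Q = −ε − μ'`, `G_Q = −G`; resolution (XII) applied to `𝓗F`, plane-wave action (XIII-b), symbol (X)).

References: Bach–Lieb–Solovej, J. Stat. Phys. 76 (1994) 3, §2 [BachLiebSolovej1994]; J. E. Hirsch, Phys. Rev. B 31 (1985) 4403 [HirschPRB1985].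
-/

noncomputable section

open Matrix Finset Literature.MathematicalPhysics.QuantumLattice Literature.Probability.LatticeModels
open scoped ComplexConjugate

namespace Summit.Ventures.CertifiedManyBodySolver.Observables

section AFTrace

variable (k : ℕ) [NeZero (2 * k)]

/-- **Diagonal of `𝓗F`, sheet `↑`**: `(𝓗F)((x,σ),(x,σ)) = L⁻² Σ_p [u_σ(p) + (−1)^x t_σ(p)]` (`2k ≥ 3`).
[cite: BachLiebSolovej1994, §2] [cite: HirschPRB1985] -/
theorem afNambu_mul_fermi_diag_zero (hL : 3 ≤ 2 * k) (μ' h M β : ℝ) (x : FermionTorus 2 (2 * k)) :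
    ((bdgNambuMatrix
        (fun x y => if (fermionTorusGraph 2 (2 * k)).Adj x y then -(1 : ℂ) else 0)
        (fun u v : FermionTorus 2 (2 * k) => -(h : ℂ) * ∑ i : Fin 2,
          if v = FermionTorus.ofTorusSite (u.toTorusSite + Pi.single i 1) then
            ((Real.sqrt 2 * (if i = 0 then 1 else -1) : ℝ) : ℂ) else 0) μ' +
      diagonal fun i : Orb (FermionTorus 2 (2 * k)) => ((M * neelSign ((ofLex i).1.toTorusSite) : ℝ) : ℂ)) *
      (1 + NormedSpace.exp ((β : ℂ) • (bdgNambuMatrix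
        (fun x y => if (fermionTorusGraph 2 (2 * k)).Adj x y then -(1 : ℂ) else 0)
        (fun u v : FermionTorus 2 (2 * k) => -(h : ℂ) * ∑ i : Fin 2,
          if v = FermionTorus.ofTorusSite (u.toTorusSite + Pi.single i 1) then
            ((Real.sqrt 2 * (if i = 0 then 1 else -1) : ℝ) : ℂ) else 0) μ' +
      diagonal fun i : Orb (FermionTorus 2 (2 * k)) => ((M * neelSign ((ofLex i).1.toTorusSite) : ℝ) : ℂ))))⁻¹) (orb x 0) (orb x 0) =
      (((2 * k : ℕ) : ℂ) ^ 2)⁻¹ * ∑ p : TorusSite 2 (2 * k),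
        (((((1 / 2 -
          Real.tanh (β * Real.sqrt ((Real.sqrt (torusBand (2 * k) p ^ 2 + M ^ 2) + |μ'|) ^ 2 + (2 * Real.sqrt 2 * h * dWaveGap p) ^ 2) / 2) /
              (2 * Real.sqrt ((Real.sqrt (torusBand (2 * k) p ^ 2 + M ^ 2) + |μ'|) ^ 2 + (2 * Real.sqrt 2 * h * dWaveGap p) ^ 2)) *
            ((torusBand (2 * k) p - μ') / 2 - μ' / (2 * |μ'| * Real.sqrt (torusBand (2 * k) p ^ 2 + M ^ 2)) *
              (torusBand (2 * k) p ^ 2 + M ^ 2 - torusBand (2 * k) p * μ')) -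
          Real.tanh (β * Real.sqrt ((Real.sqrt (torusBand (2 * k) p ^ 2 + M ^ 2) - |μ'|) ^ 2 + (2 * Real.sqrt 2 * h * dWaveGap p) ^ 2) / 2) /
              (2 * Real.sqrt ((Real.sqrt (torusBand (2 * k) p ^ 2 + M ^ 2) - |μ'|) ^ 2 + (2 * Real.sqrt 2 * h * dWaveGap p) ^ 2)) *
            ((torusBand (2 * k) p - μ') / 2 + μ' / (2 * |μ'| * Real.sqrt (torusBand (2 * k) p ^ 2 + M ^ 2)) *
              (torusBand (2 * k) p ^ 2 + M ^ 2 - torusBand (2 * k) p * μ'))) * (torusBand (2 * k) p - μ') + (-(2 * Real.sqrt 2 * h * dWaveGap p) *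
          (Real.tanh (β * Real.sqrt ((Real.sqrt (torusBand (2 * k) p ^ 2 + M ^ 2) + |μ'|) ^ 2 + (2 * Real.sqrt 2 * h * dWaveGap p) ^ 2) / 2) /
              (2 * Real.sqrt ((Real.sqrt (torusBand (2 * k) p ^ 2 + M ^ 2) + |μ'|) ^ 2 + (2 * Real.sqrt 2 * h * dWaveGap p) ^ 2)) *
            (1 / 2 - μ' / (2 * |μ'| * Real.sqrt (torusBand (2 * k) p ^ 2 + M ^ 2)) * torusBand (2 * k) p) +
          Real.tanh (β * Real.sqrt ((Real.sqrt (torusBand (2 * k) p ^ 2 + M ^ 2) - |μ'|) ^ 2 + (2 * Real.sqrt 2 * h * dWaveGap p) ^ 2) / 2) /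
              (2 * Real.sqrt ((Real.sqrt (torusBand (2 * k) p ^ 2 + M ^ 2) - |μ'|) ^ 2 + (2 * Real.sqrt 2 * h * dWaveGap p) ^ 2)) *
            (1 / 2 + μ' / (2 * |μ'| * Real.sqrt (torusBand (2 * k) p ^ 2 + M ^ 2)) * torusBand (2 * k) p))) * (2 * Real.sqrt 2 * h * dWaveGap p) + (-M *
          (Real.tanh (β * Real.sqrt ((Real.sqrt (torusBand (2 * k) p ^ 2 + M ^ 2) + |μ'|) ^ 2 + (2 * Real.sqrt 2 * h * dWaveGap p) ^ 2) / 2) /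
              (2 * Real.sqrt ((Real.sqrt (torusBand (2 * k) p ^ 2 + M ^ 2) + |μ'|) ^ 2 + (2 * Real.sqrt 2 * h * dWaveGap p) ^ 2)) *
            (1 / 2 + μ' / (2 * |μ'| * Real.sqrt (torusBand (2 * k) p ^ 2 + M ^ 2)) * μ') +
          Real.tanh (β * Real.sqrt ((Real.sqrt (torusBand (2 * k) p ^ 2 + M ^ 2) - |μ'|) ^ 2 + (2 * Real.sqrt 2 * h * dWaveGap p) ^ 2) / 2) /
              (2 * Real.sqrt ((Real.sqrt (torusBand (2 * k) p ^ 2 + M ^ 2) - |μ'|) ^ 2 + (2 * Real.sqrt 2 * h * dWaveGap p) ^ 2)) *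
            (1 / 2 - μ' / (2 * |μ'| * Real.sqrt (torusBand (2 * k) p ^ 2 + M ^ 2)) * μ'))) * M) : ℝ) : ℂ) + (neelSign x.toTorusSite : ℂ) * ((((1 / 2 -
          Real.tanh (β * Real.sqrt ((Real.sqrt (torusBand (2 * k) p ^ 2 + M ^ 2) + |μ'|) ^ 2 + (2 * Real.sqrt 2 * h * dWaveGap p) ^ 2) / 2) /
              (2 * Real.sqrt ((Real.sqrt (torusBand (2 * k) p ^ 2 + M ^ 2) + |μ'|) ^ 2 + (2 * Real.sqrt 2 * h * dWaveGap p) ^ 2)) *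
            ((torusBand (2 * k) p - μ') / 2 - μ' / (2 * |μ'| * Real.sqrt (torusBand (2 * k) p ^ 2 + M ^ 2)) *
              (torusBand (2 * k) p ^ 2 + M ^ 2 - torusBand (2 * k) p * μ')) -
          Real.tanh (β * Real.sqrt ((Real.sqrt (torusBand (2 * k) p ^ 2 + M ^ 2) - |μ'|) ^ 2 + (2 * Real.sqrt 2 * h * dWaveGap p) ^ 2) / 2) /
              (2 * Real.sqrt ((Real.sqrt (torusBand (2 * k) p ^ 2 + M ^ 2) - |μ'|) ^ 2 + (2 * Real.sqrt 2 * h * dWaveGap p) ^ 2)) *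
            ((torusBand (2 * k) p - μ') / 2 + μ' / (2 * |μ'| * Real.sqrt (torusBand (2 * k) p ^ 2 + M ^ 2)) *
              (torusBand (2 * k) p ^ 2 + M ^ 2 - torusBand (2 * k) p * μ'))) * M + (-M *
          (Real.tanh (β * Real.sqrt ((Real.sqrt (torusBand (2 * k) p ^ 2 + M ^ 2) + |μ'|) ^ 2 + (2 * Real.sqrt 2 * h * dWaveGap p) ^ 2) / 2) /
              (2 * Real.sqrt ((Real.sqrt (torusBand (2 * k) p ^ 2 + M ^ 2) + |μ'|) ^ 2 + (2 * Real.sqrt 2 * h * dWaveGap p) ^ 2)) *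
            (1 / 2 + μ' / (2 * |μ'| * Real.sqrt (torusBand (2 * k) p ^ 2 + M ^ 2)) * μ') +
          Real.tanh (β * Real.sqrt ((Real.sqrt (torusBand (2 * k) p ^ 2 + M ^ 2) - |μ'|) ^ 2 + (2 * Real.sqrt 2 * h * dWaveGap p) ^ 2) / 2) /
              (2 * Real.sqrt ((Real.sqrt (torusBand (2 * k) p ^ 2 + M ^ 2) - |μ'|) ^ 2 + (2 * Real.sqrt 2 * h * dWaveGap p) ^ 2)) *
            (1 / 2 - μ' / (2 * |μ'| * Real.sqrt (torusBand (2 * k) p ^ 2 + M ^ 2)) * μ'))) * (-torusBand (2 * k) p - μ') + (-(μ' / (2 * |μ'| * Real.sqrt (torusBand (2 * k) p ^ 2 + M ^ 2))) * M * (2 * Real.sqrt 2 * h * dWaveGap p) *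
          (Real.tanh (β * Real.sqrt ((Real.sqrt (torusBand (2 * k) p ^ 2 + M ^ 2) + |μ'|) ^ 2 + (2 * Real.sqrt 2 * h * dWaveGap p) ^ 2) / 2) /
              (2 * Real.sqrt ((Real.sqrt (torusBand (2 * k) p ^ 2 + M ^ 2) + |μ'|) ^ 2 + (2 * Real.sqrt 2 * h * dWaveGap p) ^ 2)) -
            Real.tanh (β * Real.sqrt ((Real.sqrt (torusBand (2 * k) p ^ 2 + M ^ 2) - |μ'|) ^ 2 + (2 * Real.sqrt 2 * h * dWaveGap p) ^ 2) / 2) /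
              (2 * Real.sqrt ((Real.sqrt (torusBand (2 * k) p ^ 2 + M ^ 2) - |μ'|) ^ 2 + (2 * Real.sqrt 2 * h * dWaveGap p) ^ 2)))) * (-(2 * Real.sqrt 2 * h * dWaveGap p))) : ℝ) : ℂ)) := by
  refine (apply_orb_eq_sum_mulVec_planeWave _ (orb x 0) x 0).trans ?_
  congr 1
  refine Finset.sum_congr rfl fun p _ => ?_
  rw [← Matrix.mulVec_mulVec, fermi_afNambu_mulVec_planeWave_zero k hL μ' h M β p, afNambu_planeWaveComb_resolve_zero k hL]
  push_cast
  ring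

/-- **Diagonal of `𝓗F`, sheet `↓`**: `(𝓗F)((x,σ),(x,σ)) = L⁻² Σ_p [u_σ(p) + (−1)^x t_σ(p)]` (`2k ≥ 3`).
[cite: BachLiebSolovej1994, §2] [cite: HirschPRB1985] -/
theorem afNambu_mul_fermi_diag_one (hL : 3 ≤ 2 * k) (μ' h M β : ℝ) (x : FermionTorus 2 (2 * k)) :
    ((bdgNambuMatrix
        (fun x y => if (fermionTorusGraph 2 (2 * k)).Adj x y then -(1 : ℂ) else 0)
        (fun u v : FermionTorus 2 (2 * k) => -(h : ℂ) * ∑ i : Fin 2,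
          if v = FermionTorus.ofTorusSite (u.toTorusSite + Pi.single i 1) then
            ((Real.sqrt 2 * (if i = 0 then 1 else -1) : ℝ) : ℂ) else 0) μ' +
      diagonal fun i : Orb (FermionTorus 2 (2 * k)) => ((M * neelSign ((ofLex i).1.toTorusSite) : ℝ) : ℂ)) *
      (1 + NormedSpace.exp ((β : ℂ) • (bdgNambuMatrix
        (fun x y => if (fermionTorusGraph 2 (2 * k)).Adj x y then -(1 : ℂ) else 0)
        (fun u v : FermionTorus 2 (2 * k) => -(h : ℂ) * ∑ i : Fin 2,
          if v = FermionTorus.ofTorusSite (u.toTorusSite + Pi.single i 1) then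
            ((Real.sqrt 2 * (if i = 0 then 1 else -1) : ℝ) : ℂ) else 0) μ' +
      diagonal fun i : Orb (FermionTorus 2 (2 * k)) => ((M * neelSign ((ofLex i).1.toTorusSite) : ℝ) : ℂ))))⁻¹) (orb x 1) (orb x 1) =
      (((2 * k : ℕ) : ℂ) ^ 2)⁻¹ * ∑ p : TorusSite 2 (2 * k),
        (((((-(2 * Real.sqrt 2 * h * dWaveGap p) *
          (Real.tanh (β * Real.sqrt ((Real.sqrt (torusBand (2 * k) p ^ 2 + M ^ 2) + |μ'|) ^ 2 + (2 * Real.sqrt 2 * h * dWaveGap p) ^ 2) / 2) /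
              (2 * Real.sqrt ((Real.sqrt (torusBand (2 * k) p ^ 2 + M ^ 2) + |μ'|) ^ 2 + (2 * Real.sqrt 2 * h * dWaveGap p) ^ 2)) *
            (1 / 2 - μ' / (2 * |μ'| * Real.sqrt (torusBand (2 * k) p ^ 2 + M ^ 2)) * torusBand (2 * k) p) +
          Real.tanh (β * Real.sqrt ((Real.sqrt (torusBand (2 * k) p ^ 2 + M ^ 2) - |μ'|) ^ 2 + (2 * Real.sqrt 2 * h * dWaveGap p) ^ 2) / 2) /
              (2 * Real.sqrt ((Real.sqrt (torusBand (2 * k) p ^ 2 + M ^ 2) - |μ'|) ^ 2 + (2 * Real.sqrt 2 * h * dWaveGap p) ^ 2)) *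
            (1 / 2 + μ' / (2 * |μ'| * Real.sqrt (torusBand (2 * k) p ^ 2 + M ^ 2)) * torusBand (2 * k) p))) * (2 * Real.sqrt 2 * h * dWaveGap p) - (1 / 2 +
          Real.tanh (β * Real.sqrt ((Real.sqrt (torusBand (2 * k) p ^ 2 + M ^ 2) + |μ'|) ^ 2 + (2 * Real.sqrt 2 * h * dWaveGap p) ^ 2) / 2) /
              (2 * Real.sqrt ((Real.sqrt (torusBand (2 * k) p ^ 2 + M ^ 2) + |μ'|) ^ 2 + (2 * Real.sqrt 2 * h * dWaveGap p) ^ 2)) *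
            ((torusBand (2 * k) p - μ') / 2 - μ' / (2 * |μ'| * Real.sqrt (torusBand (2 * k) p ^ 2 + M ^ 2)) *
              (torusBand (2 * k) p ^ 2 + M ^ 2 - torusBand (2 * k) p * μ')) +
          Real.tanh (β * Real.sqrt ((Real.sqrt (torusBand (2 * k) p ^ 2 + M ^ 2) - |μ'|) ^ 2 + (2 * Real.sqrt 2 * h * dWaveGap p) ^ 2) / 2) /
              (2 * Real.sqrt ((Real.sqrt (torusBand (2 * k) p ^ 2 + M ^ 2) - |μ'|) ^ 2 + (2 * Real.sqrt 2 * h * dWaveGap p) ^ 2)) *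
            ((torusBand (2 * k) p - μ') / 2 + μ' / (2 * |μ'| * Real.sqrt (torusBand (2 * k) p ^ 2 + M ^ 2)) *
              (torusBand (2 * k) p ^ 2 + M ^ 2 - torusBand (2 * k) p * μ'))) * (torusBand (2 * k) p - μ') + (-M *
          (Real.tanh (β * Real.sqrt ((Real.sqrt (torusBand (2 * k) p ^ 2 + M ^ 2) + |μ'|) ^ 2 + (2 * Real.sqrt 2 * h * dWaveGap p) ^ 2) / 2) /
              (2 * Real.sqrt ((Real.sqrt (torusBand (2 * k) p ^ 2 + M ^ 2) + |μ'|) ^ 2 + (2 * Real.sqrt 2 * h * dWaveGap p) ^ 2)) *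
            (1 / 2 + μ' / (2 * |μ'| * Real.sqrt (torusBand (2 * k) p ^ 2 + M ^ 2)) * μ') +
          Real.tanh (β * Real.sqrt ((Real.sqrt (torusBand (2 * k) p ^ 2 + M ^ 2) - |μ'|) ^ 2 + (2 * Real.sqrt 2 * h * dWaveGap p) ^ 2) / 2) /
              (2 * Real.sqrt ((Real.sqrt (torusBand (2 * k) p ^ 2 + M ^ 2) - |μ'|) ^ 2 + (2 * Real.sqrt 2 * h * dWaveGap p) ^ 2)) *
            (1 / 2 - μ' / (2 * |μ'| * Real.sqrt (torusBand (2 * k) p ^ 2 + M ^ 2)) * μ'))) * M) : ℝ) : ℂ) + (neelSign x.toTorusSite : ℂ) * ((((1 / 2 +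
          Real.tanh (β * Real.sqrt ((Real.sqrt (torusBand (2 * k) p ^ 2 + M ^ 2) + |μ'|) ^ 2 + (2 * Real.sqrt 2 * h * dWaveGap p) ^ 2) / 2) /
              (2 * Real.sqrt ((Real.sqrt (torusBand (2 * k) p ^ 2 + M ^ 2) + |μ'|) ^ 2 + (2 * Real.sqrt 2 * h * dWaveGap p) ^ 2)) *
            ((torusBand (2 * k) p - μ') / 2 - μ' / (2 * |μ'| * Real.sqrt (torusBand (2 * k) p ^ 2 + M ^ 2)) *
              (torusBand (2 * k) p ^ 2 + M ^ 2 - torusBand (2 * k) p * μ')) +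
          Real.tanh (β * Real.sqrt ((Real.sqrt (torusBand (2 * k) p ^ 2 + M ^ 2) - |μ'|) ^ 2 + (2 * Real.sqrt 2 * h * dWaveGap p) ^ 2) / 2) /
              (2 * Real.sqrt ((Real.sqrt (torusBand (2 * k) p ^ 2 + M ^ 2) - |μ'|) ^ 2 + (2 * Real.sqrt 2 * h * dWaveGap p) ^ 2)) *
            ((torusBand (2 * k) p - μ') / 2 + μ' / (2 * |μ'| * Real.sqrt (torusBand (2 * k) p ^ 2 + M ^ 2)) *
              (torusBand (2 * k) p ^ 2 + M ^ 2 - torusBand (2 * k) p * μ'))) * M + (μ' / (2 * |μ'| * Real.sqrt (torusBand (2 * k) p ^ 2 + M ^ 2)) * M * (2 * Real.sqrt 2 * h * dWaveGap p) *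
          (Real.tanh (β * Real.sqrt ((Real.sqrt (torusBand (2 * k) p ^ 2 + M ^ 2) + |μ'|) ^ 2 + (2 * Real.sqrt 2 * h * dWaveGap p) ^ 2) / 2) /
              (2 * Real.sqrt ((Real.sqrt (torusBand (2 * k) p ^ 2 + M ^ 2) + |μ'|) ^ 2 + (2 * Real.sqrt 2 * h * dWaveGap p) ^ 2)) -
            Real.tanh (β * Real.sqrt ((Real.sqrt (torusBand (2 * k) p ^ 2 + M ^ 2) - |μ'|) ^ 2 + (2 * Real.sqrt 2 * h * dWaveGap p) ^ 2) / 2) /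
              (2 * Real.sqrt ((Real.sqrt (torusBand (2 * k) p ^ 2 + M ^ 2) - |μ'|) ^ 2 + (2 * Real.sqrt 2 * h * dWaveGap p) ^ 2)))) * (-(2 * Real.sqrt 2 * h * dWaveGap p)) - (-M *
          (Real.tanh (β * Real.sqrt ((Real.sqrt (torusBand (2 * k) p ^ 2 + M ^ 2) + |μ'|) ^ 2 + (2 * Real.sqrt 2 * h * dWaveGap p) ^ 2) / 2) /
              (2 * Real.sqrt ((Real.sqrt (torusBand (2 * k) p ^ 2 + M ^ 2) + |μ'|) ^ 2 + (2 * Real.sqrt 2 * h * dWaveGap p) ^ 2)) *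
            (1 / 2 + μ' / (2 * |μ'| * Real.sqrt (torusBand (2 * k) p ^ 2 + M ^ 2)) * μ') +
          Real.tanh (β * Real.sqrt ((Real.sqrt (torusBand (2 * k) p ^ 2 + M ^ 2) - |μ'|) ^ 2 + (2 * Real.sqrt 2 * h * dWaveGap p) ^ 2) / 2) /
              (2 * Real.sqrt ((Real.sqrt (torusBand (2 * k) p ^ 2 + M ^ 2) - |μ'|) ^ 2 + (2 * Real.sqrt 2 * h * dWaveGap p) ^ 2)) *
            (1 / 2 - μ' / (2 * |μ'| * Real.sqrt (torusBand (2 * k) p ^ 2 + M ^ 2)) * μ'))) * (-torusBand (2 * k) p - μ')) : ℝ) : ℂ)) := by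
  refine (apply_orb_eq_sum_mulVec_planeWave _ (orb x 1) x 1).trans ?_
  congr 1
  refine Finset.sum_congr rfl fun p _ => ?_
  rw [← Matrix.mulVec_mulVec, fermi_afNambu_mulVec_planeWave_one k hL μ' h M β p, afNambu_planeWaveComb_resolve_one k hL]
  push_cast
  ring

end AFTrace

end Summit.Ventures.CertifiedManyBodySolver.Observables

end
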